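import Summits.BirchSwinnertonDyer.Rank1Residual.AdditivePotMult.QuadraticTwistTamagawaTypeIVPlace
import Summits.BirchSwinnertonDyer.Rank1Residual.AdditivePotMult.QuadraticTwistTamagawaTypeIVPlaceTwo
import Summits.BirchSwinnertonDyer.Rank1Residual.AdditivePotMult.QuadraticTwistTamagawaAdditive
import Summits.BirchSwinnertonDyer.Rank1Residual.AdditivePotMult.QuadraticBaseChangeOddTamagawaDictionary
import Summits.BirchSwinnertonDyer.Rank1Residual.X11b.Three.TamagawaAtom
import Literature.NumberTheory.EllipticCurves.HeegnerPoints
import Literature.NumberTheory.EllipticCurves.TamagawaRingEquivProofs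
import Literature.NumberTheory.EllipticCurves.RootNumberTwistProofs
import Literature.NumberTheory.EllipticCurves.BSDSelmerSkinnerThmBProofs
import Literature.NumberTheory.EllipticCurves.SzpiroLocalDataProofs
import Literature.NumberTheory.EllipticCurves.PAdicLFunctionQuadraticTwistBirchSharedPrimesProofs
import Literature.NumberTheory.DiophantineGeometry.ConductorRingOfIntegersProofs
import Literature.NumberTheory.DiophantineGeometry.ConductorAdditiveProofs
import Literature.NumberTheory.DiophantineGeometry.LocalReductionProofs
import Literature.NumberTheory.QuadraticFields.KroneckerSplitting
import Literature.NumberTheory.QuadraticFields.HeegnerCondition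
import HarnessLib

/-!
# Crux 23422 `EulerHalvesAtThreeResidualUpperBound`, line `cartan`: the stub (F5′) `stub_cartanPlaceTwistLawAtThree` —
# Tate's algorithm at a Cartan place under the unramified quadratic twist (PROVED, sorry-free)

Seat `bsd-stepL-tam3-p1` (g20), LINE OWNER of crux 19109 `EulerHalvesAtThree` and of its output-form residue
23422 (RULING 78 (α)). bsd-idea-10's non-split Cartan road (`CartanKernel.cartanRoadAtThree_of_inputs`, p662140) has
three displayed inputs; this file discharges the second one, the binder `hF5` — VERBATIM the registered stub signature of
`Cruxes/EulerHalvesAtThreeResidualUpperBound/Lines/cartan.lean` v4a: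

at a Cartan place `q` of `E` (`q ≠ 3`, `q² ∥ N_E`, `3 ∣ c_q(E)`), for `K` imaginary quadratic with `q` INERT (one prime
above `q`, `q ∤ d_K`) and ANY globally minimal model `Wd` of the `d_K`-twist:
`ord₃ c_q(E) + ord₃ c_q(E^{d_K}) ≤ 1` and `E^{d_K}` is not multiplicative at `q`.

Proof (a port; every local input is a tree theorem): `q² ∣ N` makes `q` additive (`two_le_conductorExponent_iff`), so
`3 ∣ c_q` forces Kodaira type `IV` ∕ `IV*` with `c_q = 3` (`Three.split_or_typeIV_of_odd_prime_dvd_localTamagawaNumber`);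
inertness reads `(d_K ∕ q) = −1` at odd `q` (`Quadratic.ncard_primesOver_eq_two_iff_legendreSym`) and `d_K ≡ 5 (mod 8)` at
`q = 2` (`Quadratic.ncard_primesOver_two_eq_two_iff`, Stickelberger); the FLIP `ord₃ c_q(E) + ord₃ c_q(E^{d}) = 1` is the
tree's `TypeIVTwist.padicValNat_localTamagawaNumber_add_quadraticTwist_eq_one_of_kodairaSymbolAt_eq_IV[star]` (odd `q`) ∕
`TypeIVTwistTwo.…_two_…` (`q = 2`), transported to `ℚ_q ∕ ℤ_q` and to the model `Wd` (`localTamagawaNumber_padic_eq`,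
`localTamagawaNumber_eq_of_variableChange_eq`); non-multiplicativity: the unit twist of an additive odd place is additive
(`hasAdditiveReductionAt_quadraticTwist_of_not_dvd`), and at `2` the conductor exponents of `E` and `E^{(d)}` agree for
`d ≡ 1 (mod 4)`, `2 ∤ d` (`factorization_conductorNorm_quadraticTwist_eq_of_not_dvd`), so `4 ∣ N(E^{(d)})`.
Nothing is asserted about any particular curve; BSD is proved for no curve; no summit statement is proved by this file.
-/

set_option linter.dupNamespace false
set_option autoImplicit false

noncomputable section

open scoped Classical NumberField

namespace Summit.BirchSwinnertonDyer.BirchSwinnertonDyer.Theorems.CartanPlaceTwistLaw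

open WeierstrassCurve IsDedekindDomain NumberField IsLocalRing Rat.HeightOneSpectrum
  Literature.NumberTheory.EllipticCurves Literature.NumberTheory.QuadraticFields.Quadratic
  Summit.BirchSwinnertonDyer.Rank1Residual.AdditivePotMult

/-! ### §1 The quadratic field side: an inert unramified prime -/

/-- In a quadratic field, an ODD prime `q ∤ d_K` with exactly one prime above it is inert: `(d_K ∕ q) = −1`, i.e. `d_K` is a
non-square mod `q` (decomposition law, Marcus Ch. 3 Thm. 25; tree `ncard_primesOver_eq_two_iff_legendreSym`). [folklore] -/
theorem not_isSquare_discr_of_inert {K : Type} [Field K] [NumberField K] (h2 : Module.finrank ℚ K = 2)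
    {q : ℕ} [hq : Fact q.Prime] (hq2 : q ≠ 2)
    (h1 : ((Ideal.span {(q : ℤ)}).primesOver (𝓞 K)).ncard = 1) (hnd : ¬ (q : ℤ) ∣ NumberField.discr K) :
    ¬ IsSquare ((NumberField.discr K : ℤ) : ZMod q) := by
  have hne : legendreSym q (NumberField.discr K) ≠ 1 := fun h ↦ by
    have := (ncard_primesOver_eq_two_iff_legendreSym (K := K) h2 hq2).mpr h
    omega
  have h0 : ((NumberField.discr K : ℤ) : ZMod q) ≠ 0 := fun h ↦
    hnd ((ZMod.intCast_zmod_eq_zero_iff_dvd _ q).mp h)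
  exact (legendreSym.eq_neg_one_iff q).mp ((legendreSym.eq_neg_one_iff_not_one q h0).mpr hne)

/-- In a quadratic field, if `2 ∤ d_K` and exactly one prime lies above `2`, then `d_K ≡ 5 (mod 8)` (Stickelberger
`d_K ≡ 1 (mod 4)` for odd `d_K`, and `2` splits iff `d_K ≡ 1 (mod 8)`; tree `discr_emod_four`, `ncard_primesOver_two_eq_two_iff`).
[folklore] -/
theorem discr_emod_eight_eq_five_of_inert_two {K : Type} [Field K] [NumberField K] (h2 : Module.finrank ℚ K = 2)
    (h1 : ((Ideal.span {(2 : ℤ)}).primesOver (𝓞 K)).ncard = 1) (hnd : ¬ (2 : ℤ) ∣ NumberField.discr K) :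
    NumberField.discr K % 8 = 5 := by
  have hne : NumberField.discr K % 8 ≠ 1 := fun h ↦ by
    have := (ncard_primesOver_two_eq_two_iff (K := K) h2).mpr h
    omega
  rcases discr_emod_four (K := K) h2 with h0 | h4
  · exact absurd (Int.dvd_of_emod_eq_zero (by omega)) hnd
  · omega

/-! ### §2 The curve side at a Cartan place -/

/-- `q² ∣ N_E` makes the place over `q` ADDITIVE (`f_q ≥ 2`; Silverman *ATAEC* IV.10.2 (c), tree `two_le_conductorExponent_iff`).
[cite: SilvermanATAEC1994, IV.10.2(c)] -/
theorem hasAdditiveReductionAt_of_sq_dvd_conductorNorm (W : WeierstrassCurve ℚ) [W.IsElliptic]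
    (v : HeightOneSpectrum (𝓞 ℚ)) (hsq : (primesEquiv v : ℕ) ^ 2 ∣ W.conductorNorm ℤ) :
    W.HasAdditiveReductionAt v := by
  haveI : Finite (ResidueField (v.adicCompletionIntegers ℚ)) := finite_residueField_adicCompletionIntegers_rat v
  haveI : PerfectField (ResidueField (v.adicCompletionIntegers ℚ)) := PerfectField.ofFinite
  have hN : W.conductorNorm ℤ ≠ 0 := (WeierstrassCurve.conductorNorm_pos_holds W).ne'
  have h4 : (W.conductorNorm ℤ).factorization (primesEquiv v : ℕ) = W.conductorExponent v := by
    rw [WeierstrassCurve.conductorExponent_ringOfIntegers_eq W v]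
    exact WeierstrassCurve.factorization_conductorNorm_primesEquiv_symm W (primesEquiv v)
  have h2f : 2 ≤ (W.conductorNorm ℤ).factorization (primesEquiv v : ℕ) :=
    ((primesEquiv v).2.pow_dvd_iff_le_factorization hN).mp hsq
  exact (two_le_conductorExponent_iff_holds v W).mp (by rw [← h4]; exact h2f)

/-- At an additive place, `3 ∣ c_q(E)` forces Kodaira type `IV` or `IV*` (Tate's algorithm, Table 4.1: the only additive types with
`3 ∣ c` ; tree `Three.split_or_typeIV_of_odd_prime_dvd_localTamagawaNumber`). [cite: SilvermanATAEC1994, IV.9.4 Steps 5 and 8, Table 4.1] -/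
theorem kodairaSymbolAt_IV_or_IVstar_of_additive_of_three_dvd (W : WeierstrassCurve ℚ) [W.IsElliptic]
    (v : HeightOneSpectrum (𝓞 ℚ)) (hadd : W.HasAdditiveReductionAt v)
    (hc : 3 ∣ (W.baseChange (v.adicCompletion ℚ)).localTamagawaNumber (v.adicCompletionIntegers ℚ)) :
    W.kodairaSymbolAt v = .IV ∨ W.kodairaSymbolAt v = .IVstar := by
  rcases Summit.BirchSwinnertonDyer.Rank1Residual.X11b.Three.split_or_typeIV_of_odd_prime_dvd_localTamagawaNumber
      W v Nat.prime_three (by decide) hc with ⟨hs, -⟩ | ⟨-, hk, -⟩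
  · exact absurd hadd hs.hasMultiplicativeReductionAt.not_hasAdditiveReductionAt
  · exact hk

/-! ### §3 The stub (F5′), VERBATIM -/

/-- **(F5′) `stub_cartanPlaceTwistLawAtThree` of line `cartan` (crux 23422), PROVED.** At a Cartan place `q` (`q ≠ 3`, `q² ∥ N`,
`3 ∣ c_q`), for `K` imaginary quadratic with `q` unramified-inert and any globally minimal model `Wd` of the `d_K`-twist:
`ord₃ c_q(E) + ord₃ c_q(Wd) ≤ 1` and `Wd` is NOT multiplicative at `q` (the unramified quadratic twist of a IV ∕ IV* fibre is
IV ∕ IV* with `c ∈ {1, 3}` swapped). The `hF5` binder of `CartanKernel.cartanRoadAtThree_of_inputs` (p662140).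
[cite: SilvermanATAEC1994, IV.9.4 Steps 5 and 8, Table 4.1 (PDF pp. 340–346)] [cite: SilvermanAEC2009, X.5 Cor. 5.4] -/
theorem cartanPlaceTwistLawAtThree :
    ∀ (W : WeierstrassCurve ℚ) [W.IsElliptic] [W.IsGloballyMinimal] (q : ℕ) [Fact q.Prime], q ≠ 3 →
      q ^ 2 ∣ W.conductorNorm ℤ → ¬ q ^ 3 ∣ W.conductorNorm ℤ → 3 ∣ (W.baseChange ℚ_[q]).localTamagawaNumber ℤ_[q] →
      ∀ (K : Type) [Field K] [NumberField K], IsImaginaryQuadratic K →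
        ((Ideal.span {(q : ℤ)}).primesOver (𝓞 K)).ncard = 1 → ¬ (q : ℤ) ∣ NumberField.discr K →
        ∀ (Cd : VariableChange ℚ) (Wd : WeierstrassCurve ℚ) [Wd.IsElliptic] [Wd.IsGloballyMinimal],
          Cd • W.quadraticTwist (NumberField.discr K : ℚ) = Wd →
          padicValNat 3 ((W.baseChange ℚ_[q]).localTamagawaNumber ℤ_[q]) +
              padicValNat 3 ((Wd.baseChange ℚ_[q]).localTamagawaNumber ℤ_[q]) ≤ 1 ∧
            ¬ Wd.HasMultiplicativeReductionAtPrime q := by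
  intro W _ _ q hq _ hN2 _ hc K _ _ hK h1 hnd Cd Wd _ _ hWd
  -- the place `v` of `𝓞 ℚ` over `q`
  set v : HeightOneSpectrum (𝓞 ℚ) := (primesEquiv (R := 𝓞 ℚ)).symm ⟨q, hq.out⟩ with hvdef
  have hpv : primesEquiv v = ⟨q, hq.out⟩ := by rw [hvdef, Equiv.apply_symm_apply]
  have hv : (primesEquiv v : ℕ) = q := by rw [hpv]
  set d : ℤ := NumberField.discr K with hd
  have hd0 : (d : ℚ) ≠ 0 := by exact_mod_cast NumberField.discr_ne_zero K
  haveI := W.isElliptic_quadraticTwist hd0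
  have hdv : ¬ ((primesEquiv v : ℕ) : ℤ) ∣ d := by rw [hv]; exact hnd
  -- `c_q` in the `𝒪_v` currency
  have hcW : (W.baseChange ℚ_[q]).localTamagawaNumber ℤ_[q] =
      (W.baseChange (v.adicCompletion ℚ)).localTamagawaNumber (v.adicCompletionIntegers ℚ) :=
    WeierstrassCurve.localTamagawaNumber_padic_eq_holds W v q hv
  have hcWd : (Wd.baseChange ℚ_[q]).localTamagawaNumber ℤ_[q] =
      ((W.quadraticTwist (d : ℚ)).baseChange (v.adicCompletion ℚ)).localTamagawaNumber
        (v.adicCompletionIntegers ℚ) := by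
    rw [WeierstrassCurve.localTamagawaNumber_padic_eq_holds Wd v q hv]
    exact localTamagawaNumber_eq_of_variableChange_eq hWd v
  -- `q` is additive of type `IV` ∕ `IV*`
  have hadd : W.HasAdditiveReductionAt v :=
    hasAdditiveReductionAt_of_sq_dvd_conductorNorm W v (by rw [hv]; exact hN2)
  have hk : W.kodairaSymbolAt v = .IV ∨ W.kodairaSymbolAt v = .IVstar :=
    kodairaSymbolAt_IV_or_IVstar_of_additive_of_three_dvd W v hadd (by rw [← hcW]; exact hc)
  by_cases hq2 : q = 2
  · -- the Cartan place `2`: `d_K ≡ 5 (mod 8)`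
    subst hq2
    have hd8 : d % 8 = 5 := discr_emod_eight_eq_five_of_inert_two hK.1 h1 hnd
    obtain ⟨k, hk1, hdk⟩ : ∃ k : ℤ, Odd k ∧ d = 4 * k + 1 := ⟨2 * (d / 8) + 1, ⟨d / 8, rfl⟩, by omega⟩
    have hcast : (d : ℚ) = (4 * k + 1 : ℚ) := by rw [hdk]; push_cast; ring
    refine ⟨?_, ?_⟩
    · have key : padicValNat 3 ((W.baseChange (v.adicCompletion ℚ)).localTamagawaNumber
            (v.adicCompletionIntegers ℚ)) +
          padicValNat 3 (((W.quadraticTwist (d : ℚ)).baseChange (v.adicCompletion ℚ)).localTamagawaNumber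
            (v.adicCompletionIntegers ℚ)) = 1 := by
        rcases hk with hIV | hIV
        · have := TypeIVTwistTwo.padicValNat_localTamagawaNumber_add_quadraticTwist_two_eq_one_of_kodairaSymbolAt_eq_IV
            W v hv hk1 hIV
          rwa [← hcast] at this
        · have := TypeIVTwistTwo.padicValNat_localTamagawaNumber_add_quadraticTwist_two_eq_one_of_kodairaSymbolAt_eq_IVstar
            W v hv hk1 hIV
          rwa [← hcast] at this
      rw [hcW, hcWd]
      exact key.le
    · -- `f_2(E^{(d)}) = f_2(E) ≥ 2` (`d ≡ 1 mod 4`, `2 ∤ d`), so the twist is not multiplicative at `2`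
      intro hmult
      have hmultX : (W.quadraticTwist (d : ℚ)).HasMultiplicativeReductionAtPrime 2 := by
        rw [← hWd] at hmult
        exact (hasMultiplicativeReductionAtPrime_smul_iff (W.quadraticTwist (d : ℚ)) Cd 2).mp hmult
      set vZ : HeightOneSpectrum ℤ := (primesEquiv (R := ℤ)).symm ⟨2, Nat.prime_two⟩ with hvZ
      have hgen : (natGenerator vZ : ℕ) = 2 :=
        congrArg Subtype.val ((primesEquiv (R := ℤ)).apply_symm_apply (⟨2, Nat.prime_two⟩ : Nat.Primes))
      have hd4 : d % 4 = 1 := by omega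
      have hfac := factorization_conductorNorm_quadraticTwist_eq_of_not_dvd W hd4 vZ (by rw [hgen]; exact hnd)
      rw [hgen] at hfac
      have hN : W.conductorNorm ℤ ≠ 0 := (WeierstrassCurve.conductorNorm_pos_holds W).ne'
      have hNX : (W.quadraticTwist (d : ℚ)).conductorNorm ℤ ≠ 0 :=
        (WeierstrassCurve.conductorNorm_pos_holds (W.quadraticTwist (d : ℚ))).ne'
      have h2f : 2 ≤ (W.conductorNorm ℤ).factorization 2 := (Nat.prime_two.pow_dvd_iff_le_factorization hN).mp hN2
      have hsqX : 2 ^ 2 ∣ (W.quadraticTwist (d : ℚ)).conductorNorm ℤ :=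
        (Nat.prime_two.pow_dvd_iff_le_factorization hNX).mpr (by rw [hfac]; exact h2f)
      have haddX := hasAdditiveReductionAt_of_sq_dvd_conductorNorm (W.quadraticTwist (d : ℚ)) v (by rw [hv]; exact hsqX)
      have hmultv : (W.quadraticTwist (d : ℚ)).HasMultiplicativeReductionAt v := by
        have key : ∀ (r : ℕ) (hr : Fact r.Prime), (primesEquiv v : ℕ) = r →
            @WeierstrassCurve.HasMultiplicativeReductionAtPrime (W.quadraticTwist (d : ℚ)) r hr →
            (W.quadraticTwist (d : ℚ)).HasMultiplicativeReductionAt v := by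
          rintro r hr rfl h
          exact (hasMultiplicativeReductionAtPrime_iff_hasMultiplicativeReductionAt_ringOfIntegers
            (W := W.quadraticTwist (d : ℚ)) v).mp h
        exact key 2 inferInstance hv hmultX
      exact hmultv.not_hasAdditiveReductionAt haddX
  · -- an odd Cartan place: `(d_K ∕ q) = −1`
    have hv2 : (primesEquiv v : ℕ) ≠ 2 := by rw [hv]; exact hq2
    have hns : ¬ IsSquare ((d : ℤ) : ZMod (primesEquiv v : ℕ)) := by
      rw [hv]; exact not_isSquare_discr_of_inert hK.1 hq2 h1 hnd
    refine ⟨?_, ?_⟩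
    · have key : padicValNat 3 ((W.baseChange (v.adicCompletion ℚ)).localTamagawaNumber
            (v.adicCompletionIntegers ℚ)) +
          padicValNat 3 (((W.quadraticTwist (d : ℚ)).baseChange (v.adicCompletion ℚ)).localTamagawaNumber
            (v.adicCompletionIntegers ℚ)) = 1 := by
        rcases hk with hIV | hIV
        · exact TypeIVTwist.padicValNat_localTamagawaNumber_add_quadraticTwist_eq_one_of_kodairaSymbolAt_eq_IV
            W v hv2 hdv hns hIV
        · exact TypeIVTwist.padicValNat_localTamagawaNumber_add_quadraticTwist_eq_one_of_kodairaSymbolAt_eq_IVstar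
            W v hv2 hdv hns hIV
      rw [hcW, hcWd]
      exact key.le
    · -- the unit twist of an additive odd place is additive
      intro hmult
      have haddX : (W.quadraticTwist (d : ℚ)).HasAdditiveReductionAt v :=
        (hasAdditiveReductionAt_quadraticTwist_of_not_dvd W v hv2 hdv hadd).1
      have hmultX : (W.quadraticTwist (d : ℚ)).HasMultiplicativeReductionAtPrime q := by
        rw [← hWd] at hmult
        exact (hasMultiplicativeReductionAtPrime_smul_iff (W.quadraticTwist (d : ℚ)) Cd q).mp hmult
      have hmultv : (W.quadraticTwist (d : ℚ)).HasMultiplicativeReductionAt v := by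
        have key : ∀ (r : ℕ) (hr : Fact r.Prime), (primesEquiv v : ℕ) = r →
            @WeierstrassCurve.HasMultiplicativeReductionAtPrime (W.quadraticTwist (d : ℚ)) r hr →
            (W.quadraticTwist (d : ℚ)).HasMultiplicativeReductionAt v := by
          rintro r hr rfl h
          exact (hasMultiplicativeReductionAtPrime_iff_hasMultiplicativeReductionAt_ringOfIntegers
            (W := W.quadraticTwist (d : ℚ)) v).mp h
        exact key q inferInstance hv hmultX
      exact hmultv.not_hasAdditiveReductionAt haddX

end Summit.BirchSwinnertonDyer.BirchSwinnertonDyer.Theorems.CartanPlaceTwistLaw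

end
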